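import Mathlib
import Literature.MathematicalPhysics.QuantumFieldTheory.OSReconstructionNoE1Proofs
import Literature.MathematicalPhysics.QuantumFieldTheory.OSSkeletonClusters
import Summits.QuantumFields.YangMills.Theorems.MirrorModularBoostsPlanarSpectralConeComplexTimeSlot
import HarnessLib

/-!
# Helpers for stub `stub_density_of_parts` — first-gap absorption, one-species field-vector API

Line `positivity-disc-to-operator-cone` of crux `MirrorModularBoosts.PlanarSpectralCone`
(stmt-QuantumFields-9664), second lead. Three groups of helpers used by the density stub, all for the
`e₀`-OS space `h : OSReconstructionNoE1 S.toLabelled` of a ONE-SPECIES family `S` on `ℝ⁴` (labels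
`fun _ => ()`):

1. **First-gap absorption** (ported from `Cruxes/PlanarSpectralCone/DrefuteG2FirstGap.lean`): a vector
   orthogonal to the field vectors of all strict cone chains is orthogonal to `Ψ_F` for every
   time-ordered `F` which is internally cone-ordered (`|xⱼ¹ − xᵢ¹| < xⱼ⁰ − xᵢ⁰`, `i < j`) with
   `|xᵢ¹| ≤ D` on its support: `e^{-sH}Ψ_F` is a cone-chain vector for `s > max D 0`, `s ↦ ⟪χ, e^{-sH}Ψ_F⟫` is
   holomorphic on `Re s > 0` (landed `stub_complexTimeSlot` at `a = 0`), identity theorem, strong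
   continuity at `s = 0`.
2. **One-species field-vector API** (one-species forms of the drefuter file
   `Cruxes/PlanarSpectralCone/DrefuteG4DensityAPI.lean`; the generic labelled forms live in `OneGap`):
   `⟪Ψ_F, Ψ_G⟫ = 𝔖(ΘF* ⊗ G)`, linearity of `F ↦ Ψ_F` in `ℋ`, continuity along time-ordered families,
   orthogonality passes to limits, totality.
3. **Tensor bookkeeping**: translating `tensorFin`, appending a translated `tensorFin` (with the tree's
   `tensorFin_add`), supports of translated one-point test functions.
-/

noncomputable section

namespace Summit.QuantumFields.YangMills.Cruxes.PlanarSpectralCone.PositivityDiscToOperatorCone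

open MeasureTheory Complex Set Filter Topology
open scoped InnerProductSpace ComplexConjugate SchwartzMap
open Literature.MathematicalPhysics.QuantumLattice Literature.MathematicalPhysics.AQFT
  Literature.MathematicalPhysics.QuantumFieldTheory
open Summit.QuantumFields.YangMills.Cruxes.PlanarSpectralCone.TwoMirrorLightconeSlots
  (stub_complexTimeSlot)

namespace Density

/-! ## 1. First-gap absorption -/

/-- Time translation by `s > max D 0` turns an internally cone-ordered, `|x¹| ≤ D`-bounded time-ordered
test function into a strict cone chain. -/
theorem coneChain_translate_timeVec {m : ℕ} (F : 𝓢((Fin m → EuclideanSpace ℝ (Fin 4)), ℂ))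
    (hF : IsTimeOrdered F) (D : ℝ)
    (hFD : tsupport (F : (Fin m → EuclideanSpace ℝ (Fin 4)) → ℂ) ⊆
        {x | (∀ i, |x i 1| ≤ D) ∧ ∀ i j, i < j → |x j 1 - x i 1| < x j 0 - x i 0})
    {s : ℝ} (hs : max D 0 < s) :
    tsupport ((translateMulti (SchwingerFamily.timeVec s) F :
        𝓢((Fin m → EuclideanSpace ℝ (Fin 4)), ℂ)) : (Fin m → EuclideanSpace ℝ (Fin 4)) → ℂ) ⊆
      {x | (∀ i, |x i 1| < x i 0) ∧ ∀ i j, i < j → |x j 1 - x i 1| < x j 0 - x i 0} := by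
  -- ported from Cruxes/PlanarSpectralCone/DrefuteG2FirstGap.lean
  intro x hx
  have hx' := OSReconstructionNoE1.tsupport_translateMulti_subset (SchwingerFamily.timeVec s) F hx
  simp only [Set.mem_preimage] at hx'
  obtain ⟨hD', hcone⟩ := hFD hx'
  have hpos := (hF hx').1
  have hDs : D < s := lt_of_le_of_lt (le_max_left _ _) hs
  refine ⟨fun i => ?_, fun i j hij => ?_⟩
  · have h1 := hD' i
    have h2 := hpos i
    simp only [PiLp.sub_apply, PiLp.single_apply] at h1 h2
    simp only [one_ne_zero, ↓reduceIte, sub_zero, ↓reduceIte] at h1 h2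
    linarith [abs_nonneg (x i 1)]
  · have h3 := hcone i j hij
    simp only [PiLp.sub_apply, PiLp.single_apply] at h3
    simp only [one_ne_zero, ↓reduceIte, sub_zero] at h3
    linarith

/-- **First-gap absorption.** In the `e₀` reconstruction `h` of a one-species family `S`, a vector `χ`
orthogonal to the field vectors of all strict cone chains is orthogonal to `Ψ_F` for every time-ordered
`F` that is internally cone-ordered with `|xᵢ¹| ≤ D` on its support. -/
theorem inner_fieldVec_eq_zero_of_internallyConed (S : SchwingerFamily (EuclideanSpace ℝ (Fin 4)))
    (h : OSReconstructionNoE1 S.toLabelled) (χ : h.Hilbert)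
    (hχ : ∀ (m : ℕ) (G : 𝓢((Fin m → EuclideanSpace ℝ (Fin 4)), ℂ)) (hG : IsTimeOrdered G),
      tsupport (G : (Fin m → EuclideanSpace ℝ (Fin 4)) → ℂ) ⊆
        {x | (∀ i, |x i 1| < x i 0) ∧ ∀ i j, i < j → |x j 1 - x i 1| < x j 0 - x i 0} →
      ⟪χ, h.fieldVec m (fun _ => ()) G hG⟫_ℂ = 0)
    {m : ℕ} (F : 𝓢((Fin m → EuclideanSpace ℝ (Fin 4)), ℂ)) (hF : IsTimeOrdered F) (D : ℝ)
    (hFD : tsupport (F : (Fin m → EuclideanSpace ℝ (Fin 4)) → ℂ) ⊆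
        {x | (∀ i, |x i 1| ≤ D) ∧ ∀ i j, i < j → |x j 1 - x i 1| < x j 0 - x i 0}) :
    ⟪χ, h.fieldVec m (fun _ => ()) F hF⟫_ℂ = 0 := by
  -- ported from Cruxes/PlanarSpectralCone/DrefuteG2FirstGap.lean (holomorphy: `stub_complexTimeSlot`)
  set ψF := h.fieldVec m (fun _ => ()) F hF with hψF
  -- Step 1: beyond `max D 0` the translated function is a cone chain
  have step1 : ∀ s : ℝ, max D 0 < s → ⟪χ, h.transfer s ψF⟫_ℂ = 0 := by
    intro s hs
    have hs0 : 0 ≤ s := le_trans (le_max_right _ _) hs.le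
    rw [hψF, h.transfer_fieldVec hs0]
    exact hχ m _ _ (coneChain_translate_timeVec F hF D hFD hs)
  -- Step 2: the holomorphic function (complex-time matrix element at `a = 0`)
  obtain ⟨-, g, hgd', -, -, hgr⟩ := stub_complexTimeSlot h χ ψF
  have hgd : DifferentiableOn ℂ (g 0) {τ : ℂ | 0 < τ.re} := hgd' 0
  have hg_real : ∀ x : ℝ, 0 < x → g 0 x = ⟪χ, h.transfer x ψF⟫_ℂ := fun x hx => by
    rw [hgr 0 rfl x hx, h.translate_zero_apply]
  -- Step 3: identity theorem on the right half-plane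
  have hU : IsOpen {τ : ℂ | 0 < τ.re} := isOpen_lt continuous_const Complex.continuous_re
  have hUc : IsPreconnected {τ : ℂ | 0 < τ.re} := (convex_halfSpace_re_gt 0).isPreconnected
  have hga : AnalyticOnNhd ℂ (g 0) {τ : ℂ | 0 < τ.re} := hgd.analyticOnNhd hU
  set c : ℝ := max D 0 + 1 with hc
  have hc0 : 0 < c := by rw [hc]; positivity
  have hz₀ : ((c : ℝ) : ℂ) ∈ {τ : ℂ | 0 < τ.re} := by simpa using hc0
  have hfreq : ∃ᶠ z in 𝓝[≠] ((c : ℝ) : ℂ), g 0 z = 0 := by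
    set u : ℕ → ℂ := fun n => (((c + 1 / ((n : ℝ) + 1) : ℝ)) : ℂ) with hu
    have hut : Tendsto u atTop (𝓝[≠] ((c : ℝ) : ℂ)) := by
      rw [tendsto_nhdsWithin_iff]
      refine ⟨?_, Eventually.of_forall fun n => ?_⟩
      · have h1 : Tendsto (fun n : ℕ => c + 1 / ((n : ℝ) + 1)) atTop (𝓝 (c + 0)) :=
          (tendsto_const_nhds (x := c) (f := (atTop : Filter ℕ))).add
            tendsto_one_div_add_atTop_nhds_zero_nat
        rw [add_zero] at h1
        exact (Complex.continuous_ofReal.tendsto c).comp h1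
      · simp only [hu, Set.mem_compl_iff, Set.mem_singleton_iff, Complex.ofReal_inj]
        have : 0 < 1 / ((n : ℝ) + 1) := by positivity
        linarith
    have hall : ∀ n, g 0 (u n) = 0 := by
      intro n
      have hpos : 0 < c + 1 / ((n : ℝ) + 1) := by positivity
      have hgt : max D 0 < c + 1 / ((n : ℝ) + 1) := by
        have : 0 < 1 / ((n : ℝ) + 1) := by positivity
        rw [hc]; linarith
      simp only [hu]
      rw [hg_real _ hpos]
      exact step1 _ hgt
    exact hut.frequently (Frequently.of_forall hall)
  have hzero : EqOn (g 0) 0 {τ : ℂ | 0 < τ.re} :=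
    hga.eqOn_zero_of_preconnected_of_frequently_eq_zero hUc hz₀ hfreq
  -- Step 4: all positive times
  have step4 : ∀ x : ℝ, 0 < x → ⟪χ, h.transfer x ψF⟫_ℂ = 0 := by
    intro x hx
    rw [← hg_real x hx]
    exact hzero (by simpa using hx)
  -- Step 5: strong continuity at `0`
  have hcont : Continuous fun t : ℝ => ⟪χ, h.transfer t ψF⟫_ℂ :=
    (continuous_const : Continuous fun _ : ℝ => χ).inner (h.continuous_transfer_apply ψF)
  have hlim : Tendsto (fun t : ℝ => ⟪χ, h.transfer t ψF⟫_ℂ) (𝓝[>] 0)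
      (𝓝 ⟪χ, h.transfer 0 ψF⟫_ℂ) :=
    (hcont.tendsto 0).mono_left nhdsWithin_le_nhds
  have hlim0 : Tendsto (fun t : ℝ => ⟪χ, h.transfer t ψF⟫_ℂ) (𝓝[>] 0) (𝓝 0) := by
    refine tendsto_const_nhds.congr' ?_
    filter_upwards [self_mem_nhdsWithin] with t ht
    exact (step4 t ht).symm
  have heq := tendsto_nhds_unique hlim hlim0
  rwa [h.transfer_zero, ContinuousLinearMap.id_apply] at heq

/-! ## 2. One-species field-vector API -/

section FieldVecAPI
-- one-species forms of Cruxes/PlanarSpectralCone/DrefuteG4DensityAPI.lean (generic forms: `OneGap`)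

variable {S : SchwingerFamily (EuclideanSpace ℝ (Fin 4))} (h : OSReconstructionNoE1 S.toLabelled)

/-- Sums of time-ordered test functions on `(ℝ⁴)ⁿ` are time-ordered. -/
theorem isTimeOrdered_add {n : ℕ} {F G : 𝓢((Fin n → EuclideanSpace ℝ (Fin 4)), ℂ)}
    (hF : IsTimeOrdered F) (hG : IsTimeOrdered G) : IsTimeOrdered (F + G) := by
  intro x hx
  have hsub : tsupport ((F + G : 𝓢((Fin n → EuclideanSpace ℝ (Fin 4)), ℂ)) :
        (Fin n → EuclideanSpace ℝ (Fin 4)) → ℂ) ⊆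
      tsupport (F : (Fin n → EuclideanSpace ℝ (Fin 4)) → ℂ) ∪
        tsupport (G : (Fin n → EuclideanSpace ℝ (Fin 4)) → ℂ) := by
    rw [tsupport, tsupport, tsupport, ← closure_union]
    refine closure_mono fun y hy => ?_
    by_contra hy'
    simp only [Set.mem_union, Function.mem_support, not_or, not_not] at hy'
    exact hy (by simp [hy'.1, hy'.2])
  rcases hsub hx with hx' | hx'
  · exact hF hx'
  · exact hG hx'

/-- Differences of time-ordered test functions on `(ℝ⁴)ⁿ` are time-ordered. -/
theorem isTimeOrdered_sub {n : ℕ} {F G : 𝓢((Fin n → EuclideanSpace ℝ (Fin 4)), ℂ)}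
    (hF : IsTimeOrdered F) (hG : IsTimeOrdered G) : IsTimeOrdered (F - G) := by
  rw [sub_eq_add_neg]
  refine isTimeOrdered_add hF ?_
  have : (-G : 𝓢((Fin n → EuclideanSpace ℝ (Fin 4)), ℂ)) = (-1 : ℂ) • G := by rw [neg_one_smul]
  rw [this]
  exact OSReconstructionNoE1.isTimeOrdered_smul _ hG

/-- Field vectors of equal test functions agree (the time-ordering witness is a proof). -/
theorem fieldVec_congr {n : ℕ} {F G : 𝓢((Fin n → EuclideanSpace ℝ (Fin 4)), ℂ)} (hFG : F = G)
    (hF : IsTimeOrdered F) (hG : IsTimeOrdered G) :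
    h.fieldVec n (fun _ => ()) F hF = h.fieldVec n (fun _ => ()) G hG := by
  subst hFG
  rfl

/-- **One-species pairing**: `⟪Ψ_F, Ψ_G⟫ = 𝔖_{n+m}(ΘF* ⊗ G)` (no labels). -/
theorem inner_fieldVec_fieldVec_one {n m : ℕ} {F : 𝓢((Fin n → EuclideanSpace ℝ (Fin 4)), ℂ)}
    {G : 𝓢((Fin m → EuclideanSpace ℝ (Fin 4)), ℂ)}
    (hF : IsTimeOrdered F) (hG : IsTimeOrdered G) :
    ⟪h.fieldVec n (fun _ => ()) F hF, h.fieldVec m (fun _ => ()) G hG⟫_ℂ =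
      S (n + m) ((osAdjoint F).appendTensor G) := by
  rw [h.inner_fieldVec_fieldVec _ _ hF hG (isAppendTensorOf_appendTensor _ _)]
  rfl

/-- **`Ψ_{F+G} = Ψ_F + Ψ_G`** in `ℋ` (the difference is a null vector of the OS form). -/
theorem fieldVec_add {n : ℕ} {F G : 𝓢((Fin n → EuclideanSpace ℝ (Fin 4)), ℂ)} (hF : IsTimeOrdered F)
    (hG : IsTimeOrdered G) (hFG : IsTimeOrdered (F + G)) :
    h.fieldVec n (fun _ => ()) (F + G) hFG =
      h.fieldVec n (fun _ => ()) F hF + h.fieldVec n (fun _ => ()) G hG := by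
  rw [← sub_eq_zero, ← inner_self_eq_zero (𝕜 := ℂ)]
  simp only [inner_sub_left, inner_sub_right, inner_add_left, inner_add_right,
    inner_fieldVec_fieldVec_one, osAdjoint_add, SchwartzMap.appendTensor_add_left,
    SchwartzMap.appendTensor_add_right, map_add]
  ring

/-- **`Ψ_{cF} = c Ψ_F`** in `ℋ`. -/
theorem fieldVec_smul {n : ℕ} (c : ℂ) {F : 𝓢((Fin n → EuclideanSpace ℝ (Fin 4)), ℂ)}
    (hF : IsTimeOrdered F) (hcF : IsTimeOrdered (c • F)) :
    h.fieldVec n (fun _ => ()) (c • F) hcF = c • h.fieldVec n (fun _ => ()) F hF := by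
  rw [← sub_eq_zero, ← inner_self_eq_zero (𝕜 := ℂ)]
  simp only [inner_sub_left, inner_sub_right, inner_smul_left, inner_smul_right,
    inner_fieldVec_fieldVec_one, Literature.MathematicalPhysics.QuantumLattice.osAdjoint_smul,
    SchwartzMap.appendTensor_smul_left, SchwartzMap.appendTensor_smul_right, map_smul, smul_eq_mul]
  ring

/-- **`Ψ_{F−G} = Ψ_F − Ψ_G`** in `ℋ`. -/
theorem fieldVec_sub {n : ℕ} {F G : 𝓢((Fin n → EuclideanSpace ℝ (Fin 4)), ℂ)} (hF : IsTimeOrdered F)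
    (hG : IsTimeOrdered G) (hFG : IsTimeOrdered (F - G)) :
    h.fieldVec n (fun _ => ()) (F - G) hFG =
      h.fieldVec n (fun _ => ()) F hF - h.fieldVec n (fun _ => ()) G hG := by
  have hadj : osAdjoint (F - G) = osAdjoint F - osAdjoint G := by
    rw [sub_eq_add_neg, osAdjoint_add, ← neg_one_smul ℂ G,
      Literature.MathematicalPhysics.QuantumLattice.osAdjoint_smul]
    simp [sub_eq_add_neg]
  rw [← sub_eq_zero, ← inner_self_eq_zero (𝕜 := ℂ)]
  simp only [inner_sub_left, inner_sub_right, inner_fieldVec_fieldVec_one, map_sub, hadj,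
    SchwartzMap.appendTensor_sub_left, SchwartzMap.appendTensor_sub_right]
  ring

/-- **`Ψ_0 = 0`.** -/
theorem fieldVec_zero {n : ℕ} (h0 : IsTimeOrdered (0 : 𝓢((Fin n → EuclideanSpace ℝ (Fin 4)), ℂ))) :
    h.fieldVec n (fun _ => ()) 0 h0 = 0 := by
  rw [← inner_self_eq_zero (𝕜 := ℂ), inner_fieldVec_fieldVec_one]
  have : ((osAdjoint (0 : 𝓢((Fin n → EuclideanSpace ℝ (Fin 4)), ℂ))).appendTensor
      (0 : 𝓢((Fin n → EuclideanSpace ℝ (Fin 4)), ℂ))) = 0 := by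
    ext x; simp
  rw [this, map_zero]

/-- **`‖Ψ_F‖² = Re 𝔖_{2n}(ΘF* ⊗ F)`** (one-species). -/
theorem norm_fieldVec_sq {n : ℕ} {F : 𝓢((Fin n → EuclideanSpace ℝ (Fin 4)), ℂ)}
    (hF : IsTimeOrdered F) :
    ‖h.fieldVec n (fun _ => ()) F hF‖ ^ 2 = (S (n + n) ((osAdjoint F).appendTensor F)).re := by
  rw [← inner_fieldVec_fieldVec_one h hF hF, ← inner_self_eq_norm_sq (𝕜 := ℂ)]
  rfl

/-- **Continuity of `F ↦ Ψ_F` along time-ordered families** (one-species): if `F a → G` in `𝒮` then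
`Ψ_{F a} → Ψ_G`. -/
theorem tendsto_fieldVec {α : Type*} {l : Filter α} {n : ℕ}
    {F : α → 𝓢((Fin n → EuclideanSpace ℝ (Fin 4)), ℂ)} (hF : ∀ a, IsTimeOrdered (F a))
    {G : 𝓢((Fin n → EuclideanSpace ℝ (Fin 4)), ℂ)} (hG : IsTimeOrdered G) (hlim : Tendsto F l (𝓝 G)) :
    Tendsto (fun a => h.fieldVec n (fun _ => ()) (F a) (hF a)) l
      (𝓝 (h.fieldVec n (fun _ => ()) G hG)) := by
  rw [tendsto_iff_norm_sub_tendsto_zero]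
  -- the quadratic form `A ↦ 𝔖(ΘA* ⊗ A)` is continuous on `𝒮` and vanishes at `0`
  have hq : Continuous fun A : 𝓢((Fin n → EuclideanSpace ℝ (Fin 4)), ℂ) =>
      (S (n + n) ((osAdjoint A).appendTensor A)).re :=
    Complex.continuous_re.comp ((S (n + n)).continuous.comp
      (continuous_appendTensor.comp (continuous_osAdjoint.prodMk continuous_id)))
  have h0 : Tendsto (fun a => F a - G) l (𝓝 0) := by
    have := hlim.sub (tendsto_const_nhds (x := G))
    rwa [sub_self] at this
  have h1 : Tendsto (fun a => (S (n + n) ((osAdjoint (F a - G)).appendTensor (F a - G))).re) l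
      (𝓝 0) := by
    have := (hq.tendsto 0).comp h0
    have hz : (S (n + n) ((osAdjoint (0 : 𝓢((Fin n → EuclideanSpace ℝ (Fin 4)), ℂ))).appendTensor
        0)).re = 0 := by
      have : ((osAdjoint (0 : 𝓢((Fin n → EuclideanSpace ℝ (Fin 4)), ℂ))).appendTensor
          (0 : 𝓢((Fin n → EuclideanSpace ℝ (Fin 4)), ℂ))) = 0 := by
        ext x; simp
      rw [this, map_zero, Complex.zero_re]
    simpa [Function.comp_def, hz] using this
  have h2 : ∀ a, ‖h.fieldVec n (fun _ => ()) (F a) (hF a) - h.fieldVec n (fun _ => ()) G hG‖ =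
      Real.sqrt ((S (n + n) ((osAdjoint (F a - G)).appendTensor (F a - G))).re) := by
    intro a
    rw [← fieldVec_sub h (hF a) hG (isTimeOrdered_sub (hF a) hG), ← norm_fieldVec_sq,
      Real.sqrt_sq (norm_nonneg _)]
  simp_rw [h2]
  have := h1.sqrt
  rwa [Real.sqrt_zero] at this

/-- Orthogonality passes to `𝒮`-limits of time-ordered test functions. -/
theorem inner_fieldVec_eq_zero_of_tendsto {α : Type*} {l : Filter α} [l.NeBot] {n : ℕ} (χ : h.Hilbert)
    {F : α → 𝓢((Fin n → EuclideanSpace ℝ (Fin 4)), ℂ)} (hF : ∀ a, IsTimeOrdered (F a))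
    {G : 𝓢((Fin n → EuclideanSpace ℝ (Fin 4)), ℂ)} (hG : IsTimeOrdered G) (hlim : Tendsto F l (𝓝 G))
    (hχ : ∀ a, ⟪χ, h.fieldVec n (fun _ => ()) (F a) (hF a)⟫_ℂ = 0) :
    ⟪χ, h.fieldVec n (fun _ => ()) G hG⟫_ℂ = 0 := by
  have ht : Tendsto (fun a => ⟪χ, h.fieldVec n (fun _ => ()) (F a) (hF a)⟫_ℂ) l
      (𝓝 ⟪χ, h.fieldVec n (fun _ => ()) G hG⟫_ℂ) :=
    (tendsto_const_nhds (x := χ)).inner (tendsto_fieldVec h hF hG hlim)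
  have h0 : Tendsto (fun a => ⟪χ, h.fieldVec n (fun _ => ()) (F a) (hF a)⟫_ℂ) l (𝓝 0) := by
    simp only [hχ]; exact tendsto_const_nhds
  exact tendsto_nhds_unique ht h0

/-- **A vector orthogonal to every field vector is zero** (one-species: every `Ψ_F`, `F` time-ordered
of any arity, labels `fun _ => ()`). -/
theorem eq_zero_of_forall_inner_fieldVec_eq_zero (χ : h.Hilbert)
    (hχ : ∀ (n : ℕ) (F : 𝓢((Fin n → EuclideanSpace ℝ (Fin 4)), ℂ)) (hF : IsTimeOrdered F),
      ⟪χ, h.fieldVec n (fun _ => ()) F hF⟫_ℂ = 0) :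
    χ = 0 := by
  have hall : ∀ x : h.Hilbert, ⟪χ, x⟫_ℂ = 0 := by
    intro x
    refine h.denseRange_vec.induction_on x (isClosed_eq (continuous_const.inner continuous_id)
      continuous_const) fun v => ?_
    rw [h.vec_eq_sum_genVec, Finsupp.sum, inner_sum]
    refine Finset.sum_eq_zero fun p _ => ?_
    rw [inner_smul_right]
    obtain ⟨n, k, F, hF⟩ := p
    have hk : k = fun _ => () := funext fun _ => rfl
    subst hk
    have : h.genVec ⟨n, fun _ => (), F, hF⟩ = h.fieldVec n (fun _ => ()) F hF :=
      (h.fieldVec_eq_genVec n _ F hF).symm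
    rw [this, hχ n F hF, mul_zero]
  exact inner_self_eq_zero.1 (hall χ)

end FieldVecAPI

/-! ## 3. Tensor bookkeeping -/

section Tensor

variable {E : Type*} [NormedAddCommGroup E] [NormedSpace ℝ E]

/-- Translating a tensor product translates each factor. -/
theorem translateMulti_tensorFin {l : ℕ} (c : E) (v : Fin l → 𝓢(E, ℂ)) :
    translateMulti c (SchwartzMap.tensorFin l v) =
      SchwartzMap.tensorFin l fun j => translateTest c (v j) := by
  ext x
  simp [translateMulti_apply, SchwartzMap.tensorFin_apply, translateTest_apply]

/-- Appending a translated tensor product: `(⊗ᵢ uᵢ) ⊗ (⊗ⱼ vⱼ)_{c} = ⊗ (u ++ (v_{c}))`. -/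
theorem appendTensor_translateMulti_tensorFin {k l : ℕ} (c : E) (u : Fin k → 𝓢(E, ℂ))
    (v : Fin l → 𝓢(E, ℂ)) :
    (SchwartzMap.tensorFin k u).appendTensor (translateMulti c (SchwartzMap.tensorFin l v)) =
      SchwartzMap.tensorFin (k + l) (Fin.append u fun j => translateTest c (v j)) := by
  rw [translateMulti_tensorFin, tensorFin_add]
  simp only [Fin.append_left, Fin.append_right]

/-- The support of a translated one-point test function is the translated support. -/
theorem tsupport_translateTest_subset (c : E) (g : 𝓢(E, ℂ)) :
    tsupport ((translateTest c g : 𝓢(E, ℂ)) : E → ℂ) ⊆ (fun x => x - c) ⁻¹' tsupport (g : E → ℂ) := by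
  refine closure_minimal (fun x hx => ?_)
    ((isClosed_tsupport _).preimage (continuous_id.sub continuous_const))
  rw [Function.mem_support, translateTest_apply] at hx
  exact subset_closure (Function.mem_support.2 hx)

end Tensor

end Density

end Summit.QuantumFields.YangMills.Cruxes.PlanarSpectralCone.PositivityDiscToOperatorCone
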